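import Summits.AtomisticToContinuum.Crystallization.Theorems.FrustratedLawDichotomyStrainedPatchHomPrunes

/-!
# The FIT prunes (P1) «centre `1/20`-good» and (P2) «13 intruders ⟹ centre never good» in PARAMETRIC form
# (27623 strained-patch piece, `(H) HomFloor`; decomp-a2c, prover hand 2, generation 20; sequel to `…HomPrunes`, critic row 758)

`…HomPrunes` turns the centre clauses into «not realised»; this DEF-FREE module supplies the two remaining transfers from PARAMETRIC data
(statements about the displacement set `T` only, all quantifiers bounded by the radius `13/10·d + γ`) to the tree's two-shell fit predicate
`GoodAtScale η D z c` at the centre of a locally homogeneous ball (`hT` at radius `15/2`, as in `…HomPrunes`):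

* §1 ★ (P1) `goodAtScale_centre_of_fit_fcc / _hcpPattern`: twelve displacement vectors `t' : pattern → T` fitting `d·A·pattern` within `η'·d`, the
  pinned scale (`d ≤ ‖w‖` for every `w ∈ T ∖ 0` below `13/10·d + γ`, some `w` with `‖w‖ ≤ d`) and the clean gap (`‖w‖ < 13/10·d + γ ⟹ ‖w‖ ≤ 13/10·d − γ ∧
  w ∈ range t'`) ⟹ `GoodAtScale η D z c` (`η' < η`, `d ≤ D`, `13/10·d + γ ≤ 15/2`);
* §2 ★ (P2) `not_goodAtScale_centre_of_intruders`: a set `S ⊆ T ∖ 0` of `≥ 13` vectors each shorter than `13/10·‖w‖` for every `w ∈ T ∖ 0` with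
  `‖w‖ ≤ D` ⟹ `¬GoodAtScale η D z c` for every `η` (`D < 15/2`; the twelve-point patterns cannot host thirteen);
* §3 ★★ the «not realised» forms for the fcc / hcp families of `homFloor_iff_latticeSums` (`not_realised_fcc/hcp_of_fit_*`, `…_of_intruders`).

Reducing the bounded quantifiers `∀ w ∈ T ∖ 0, ‖w‖ < r → …` to label boxes is `…HomLatticeBox(Hcp)` (`mem_box_of_norm_fccPoint_lt`, …).
0 sorry; no definitions; axioms ⊆ {propext, Classical.choice, Quot.sound}.  `--supports stmt-AtomisticToContinuum-27623`.
-/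

noncomputable section

namespace Summit.AtomisticToContinuum.Crystallization.Theorems.FrustratedLawDichotomyStrainedPatchHomPrunesFit

open scoped BigOperators Classical
open Literature.Geometry.DiscreteGeometry (fccKissingPattern hcpKissingPattern card_fccKissingPattern card_hcpKissingPattern)
open Summit.AtomisticToContinuum.Crystallization.Theorems.ChargedEnergyGapNegative (E3)
open Summit.AtomisticToContinuum.Crystallization.Theorems.FrustratedLawDichotomyMotifLemmas (GoodAtScale)
open Summit.AtomisticToContinuum.Crystallization.Theorems.FrustratedLawDichotomyStrainedPatchHomSplit
open Summit.AtomisticToContinuum.Crystallization.Theorems.FrustratedLawDichotomyStrainedPatchHomLattice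
open Summit.AtomisticToContinuum.Crystallization.Theorems.FrustratedLawDichotomyStrainedPatchHomPrunes
open Literature.Barriers.AtomisticToContinuum.FlatleyTheil2015 (fccVec)

/-! ## §0. Bookkeeping at the centre of a locally homogeneous ball -/

/-- A displacement `w ∈ T` of norm `< 15/2` is a point of the ball. [folklore] -/
theorem mem_range_of_mem {M : ℕ} {z : Fin M → E3} {c : Fin M} {T : Set E3}
    (hT : ∀ x : E3, dist x (z c) < 15 / 2 → (x ∈ Set.range z ↔ x - z c ∈ T)) {w : E3} (hw : w ∈ T) (hw7 : ‖w‖ < 15 / 2) :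
    z c + w ∈ Set.range z :=
  (hT (z c + w) (by simpa [dist_eq_norm] using hw7)).2 (by simpa using hw)

/-- A point of the ball within `15/2` of the centre is a displacement of `T`. [folklore] -/
theorem sub_mem_of_mem_range {M : ℕ} {z : Fin M → E3} {c : Fin M} {T : Set E3}
    (hT : ∀ x : E3, dist x (z c) < 15 / 2 → (x ∈ Set.range z ↔ x - z c ∈ T)) {s : E3} (hs : s ∈ Set.range z) (hs7 : dist s (z c) < 15 / 2) :
    s - z c ∈ T :=
  (hT s hs7).1 hs

/-! ## §1. (P1) The centre is good from a parametric fit -/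

/-- ★ **(P1), fcc pattern**: a parametric two-shell fit at the centre ⟹ `GoodAtScale η D z c`. [folklore] -/
theorem goodAtScale_centre_of_fit_fcc {M : ℕ} {z : Fin M → E3} {c : Fin M} {T : Set E3}
    (hT : ∀ x : E3, dist x (z c) < 15 / 2 → (x ∈ Set.range z ↔ x - z c ∈ T)) {η D d η' γ : ℝ} {A : E3 →ₗᵢ[ℝ] E3}
    {t' : ↥fccKissingPattern → E3} (hdD : d ≤ D) (hd0 : 0 < d) (hγ0 : 0 < γ) (hη : η' < η) (hr : 13 / 10 * d + γ ≤ 15 / 2)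
    (hfit : ∀ u : ↥fccKissingPattern, t' u ∈ T ∧ ‖t' u‖ < 15 / 2 ∧ ‖t' u - d • A (u : E3)‖ ≤ η' * d)
    (hlow : ∀ w ∈ T, w ≠ 0 → ‖w‖ < 13 / 10 * d + γ → d ≤ ‖w‖)
    (hex : ∃ w ∈ T, w ≠ 0 ∧ ‖w‖ ≤ d)
    (hclean : ∀ w ∈ T, w ≠ 0 → ‖w‖ < 13 / 10 * d + γ → ‖w‖ ≤ 13 / 10 * d - γ ∧ w ∈ Set.range t') :
    GoodAtScale η D z c := by
  refine ⟨d, η', γ, A, hdD, Or.inl ⟨fun u => z c + t' u, hd0, hγ0, hη, fun u => ⟨?_, ?_⟩, ?_, ?_, ?_⟩⟩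
  · exact mem_range_of_mem hT (hfit u).1 (hfit u).2.1
  · simpa using (hfit u).2.2
  · intro s hs hne
    by_cases hlt : dist s (z c) < 13 / 10 * d + γ
    · have hw := sub_mem_of_mem_range hT hs (by linarith)
      have hw0 : s - z c ≠ 0 := sub_ne_zero.2 hne
      have := hlow _ hw hw0 (by rwa [← dist_eq_norm])
      rwa [← dist_eq_norm] at this
    · have hge := not_lt.mp hlt
      nlinarith
  · obtain ⟨w, hw, hw0, hwd⟩ := hex
    refine ⟨z c + w, mem_range_of_mem hT hw (by linarith), fun h => hw0 (by simpa using h), ?_⟩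
    simpa [dist_eq_norm] using hwd
  · intro s hs hne hlt
    have hw := sub_mem_of_mem_range hT hs (by linarith)
    have hw0 : s - z c ≠ 0 := sub_ne_zero.2 hne
    obtain ⟨hle, u, hu⟩ := hclean _ hw hw0 (by rwa [← dist_eq_norm])
    refine ⟨by rwa [← dist_eq_norm] at hle, u, ?_⟩
    simp only [hu, add_sub_cancel]

/-- ★ **(P1), hcp pattern**: the same with the anticuboctahedral pattern. [folklore] -/
theorem goodAtScale_centre_of_fit_hcpPattern {M : ℕ} {z : Fin M → E3} {c : Fin M} {T : Set E3}
    (hT : ∀ x : E3, dist x (z c) < 15 / 2 → (x ∈ Set.range z ↔ x - z c ∈ T)) {η D d η' γ : ℝ} {A : E3 →ₗᵢ[ℝ] E3}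
    {t' : ↥hcpKissingPattern → E3} (hdD : d ≤ D) (hd0 : 0 < d) (hγ0 : 0 < γ) (hη : η' < η) (hr : 13 / 10 * d + γ ≤ 15 / 2)
    (hfit : ∀ u : ↥hcpKissingPattern, t' u ∈ T ∧ ‖t' u‖ < 15 / 2 ∧ ‖t' u - d • A (u : E3)‖ ≤ η' * d)
    (hlow : ∀ w ∈ T, w ≠ 0 → ‖w‖ < 13 / 10 * d + γ → d ≤ ‖w‖)
    (hex : ∃ w ∈ T, w ≠ 0 ∧ ‖w‖ ≤ d)
    (hclean : ∀ w ∈ T, w ≠ 0 → ‖w‖ < 13 / 10 * d + γ → ‖w‖ ≤ 13 / 10 * d - γ ∧ w ∈ Set.range t') :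
    GoodAtScale η D z c := by
  refine ⟨d, η', γ, A, hdD, Or.inr ⟨fun u => z c + t' u, hd0, hγ0, hη, fun u => ⟨?_, ?_⟩, ?_, ?_, ?_⟩⟩
  · exact mem_range_of_mem hT (hfit u).1 (hfit u).2.1
  · simpa using (hfit u).2.2
  · intro s hs hne
    by_cases hlt : dist s (z c) < 13 / 10 * d + γ
    · have hw := sub_mem_of_mem_range hT hs (by linarith)
      have hw0 : s - z c ≠ 0 := sub_ne_zero.2 hne
      have := hlow _ hw hw0 (by rwa [← dist_eq_norm])
      rwa [← dist_eq_norm] at this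
    · have hge := not_lt.mp hlt
      nlinarith
  · obtain ⟨w, hw, hw0, hwd⟩ := hex
    refine ⟨z c + w, mem_range_of_mem hT hw (by linarith), fun h => hw0 (by simpa using h), ?_⟩
    simpa [dist_eq_norm] using hwd
  · intro s hs hne hlt
    have hw := sub_mem_of_mem_range hT hs (by linarith)
    have hw0 : s - z c ≠ 0 := sub_ne_zero.2 hne
    obtain ⟨hle, u, hu⟩ := hclean _ hw hw0 (by rwa [← dist_eq_norm])
    refine ⟨by rwa [← dist_eq_norm] at hle, u, ?_⟩
    simp only [hu, add_sub_cancel]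

/-! ## §2. (P2) Thirteen intruders: the centre is never good -/

/-- ★ **(P2) INTRUDER PRUNE**: `≥ 13` nonzero displacements of `T`, each shorter than `13/10·‖w‖` for every nonzero `w ∈ T` with `‖w‖ ≤ D`, forbid
every two-shell fit at scale `≤ D` (both twelve-point patterns): `¬GoodAtScale η D z c`. [folklore] -/
theorem not_goodAtScale_centre_of_intruders {M : ℕ} {z : Fin M → E3} {c : Fin M} {T : Set E3}
    (hT : ∀ x : E3, dist x (z c) < 15 / 2 → (x ∈ Set.range z ↔ x - z c ∈ T)) {η D : ℝ} (hD : D < 15 / 2)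
    {S : Finset E3} (hcard : 13 ≤ S.card) (hS : ∀ v ∈ S, v ≠ 0 ∧ v ∈ T ∧ ‖v‖ < 15 / 2)
    (hlt : ∀ v ∈ S, ∀ w ∈ T, w ≠ 0 → ‖w‖ ≤ D → ‖v‖ < 13 / 10 * ‖w‖) : ¬GoodAtScale η D z c := by
  rintro ⟨d, η', γ, A, hdD, hor⟩
  -- the common core of both branches: a pinned scale `d` with a witness, and a clean-gap clause into a twelve-point range
  have key : ∀ {P : Finset E3} (t : ↥P → E3), P.card = 12 → 0 < γ →
      (∃ s : E3, s ∈ Set.range z ∧ s ≠ z c ∧ dist s (z c) ≤ d) →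
      (∀ s : E3, s ∈ Set.range z → s ≠ z c → dist s (z c) < 13 / 10 * d + γ → dist s (z c) ≤ 13 / 10 * d - γ ∧ s ∈ Set.range t) → False := by
    intro P t hP hγ0 hex hclean
    obtain ⟨s, hs, hne, hsd⟩ := hex
    have hw : s - z c ∈ T := sub_mem_of_mem_range hT hs (by linarith)
    have hw0 : s - z c ≠ 0 := sub_ne_zero.2 hne
    have hwd : ‖s - z c‖ ≤ d := by rwa [← dist_eq_norm]
    -- every intruder lands in `range t`
    have hin : ∀ v ∈ S, z c + v ∈ Finset.univ.image t := by
      intro v hv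
      obtain ⟨hv0, hvT, hv7⟩ := hS v hv
      have hvlt : ‖v‖ < 13 / 10 * d + γ := by
        have := hlt v hv (s - z c) hw hw0 (by linarith)
        nlinarith
      have hmem := mem_range_of_mem hT hvT hv7
      obtain ⟨-, u, hu⟩ := hclean (z c + v) hmem (fun h => hv0 (by simpa using h)) (by simpa [dist_eq_norm] using hvlt)
      exact Finset.mem_image.2 ⟨u, Finset.mem_univ u, hu⟩
    have hle : S.card ≤ (Finset.univ.image t).card :=
      Finset.card_le_card_of_injOn (fun v => z c + v) (fun v hv => by simpa using hin v hv) fun a _ b _ h => by simpa using h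
    have h12 : (Finset.univ.image t).card ≤ 12 :=
      Finset.card_image_le.trans (by rw [Finset.card_univ, Fintype.card_coe, hP])
    omega
  rcases hor with ⟨t, -, hγ0, -, -, -, hex, hclean⟩ | ⟨t, -, hγ0, -, -, -, hex, hclean⟩
  · exact key t card_fccKissingPattern hγ0 hex hclean
  · exact key t card_hcpKissingPattern hγ0 hex hclean

/-! ## §3. The «not realised» forms for the two families -/

/-- ★★ **(P1) PRUNE, fcc family** (either pattern: supply the `GoodAtScale (1/20) (3/2)` conclusion of §1 with `T = G·L_fcc`):
a `1/20`-good centre ⟹ the deformation is realised by NO admissible fcc ball. [folklore] -/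
theorem not_realised_fcc_of_centre_good {G : E3 →L[ℝ] E3}
    (h : ∀ (M : ℕ) (z : Fin M → E3) (c : Fin M), Function.Injective z →
      (∀ x : E3, dist x (z c) < 15 / 2 → (x ∈ Set.range z ↔ x - z c ∈ {v : E3 | ∃ b : Fin 3 → ℤ, v = latPt G fccVec b})) →
      GoodAtScale (1 / 20) (3 / 2) z c) :
    ¬∃ (M : ℕ) (z : Fin M → E3) (c : Fin M), Admissible M z c ∧
      Set.range z = {x : E3 | dist x (z c) ≤ 133 / 10 ∧ ∃ a : Fin 3 → ℤ, x = z c + latPt G fccVec a} := by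
  rintro ⟨M, z, c, hA, hrange⟩
  exact not_admissible_of_centre_good (h M z c hA.1 (locHom_fcc_centre hrange)) hA

/-- ★★ **(P1) PRUNE, hcp family.** [folklore] -/
theorem not_realised_hcp_of_centre_good {G : E3 →L[ℝ] E3} {ξ : E3}
    (h : ∀ (M : ℕ) (z : Fin M → E3) (c : Fin M), Function.Injective z →
      (∀ x : E3, dist x (z c) < 15 / 2 → (x ∈ Set.range z ↔
        x - z c ∈ {v : E3 | ∃ b : Fin 3 → ℤ, v = latPt G hexFrame b ∨ v = latPt G hexFrame b + G (hcpShift + ξ)})) →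
      GoodAtScale (1 / 20) (3 / 2) z c) :
    ¬∃ (M : ℕ) (z : Fin M → E3) (c : Fin M), Admissible M z c ∧
      Set.range z = {x : E3 | dist x (z c) ≤ 133 / 10 ∧ ∃ a : Fin 3 → ℤ,
        x = z c + latPt G hexFrame a ∨ x = z c + latPt G hexFrame a + G (hcpShift + ξ)} := by
  rintro ⟨M, z, c, hA, hrange⟩
  exact not_admissible_of_centre_good (h M z c hA.1 (locHom_hcp_centre hrange)) hA

/-- ★★ **(P2) PRUNE, fcc family**: thirteen intruders in `G·L_fcc` ⟹ not realised (the centre would be `1/8`-bad). [folklore] -/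
theorem not_realised_fcc_of_intruders {G : E3 →L[ℝ] E3} {S : Finset E3} (hcard : 13 ≤ S.card)
    (hS : ∀ v ∈ S, v ≠ 0 ∧ v ∈ {v : E3 | ∃ b : Fin 3 → ℤ, v = latPt G fccVec b} ∧ ‖v‖ < 15 / 2)
    (hlt : ∀ v ∈ S, ∀ w ∈ {v : E3 | ∃ b : Fin 3 → ℤ, v = latPt G fccVec b}, w ≠ 0 → ‖w‖ ≤ 3 / 2 → ‖v‖ < 13 / 10 * ‖w‖) :
    ¬∃ (M : ℕ) (z : Fin M → E3) (c : Fin M), Admissible M z c ∧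
      Set.range z = {x : E3 | dist x (z c) ≤ 133 / 10 ∧ ∃ a : Fin 3 → ℤ, x = z c + latPt G fccVec a} := by
  rintro ⟨M, z, c, hA, hrange⟩
  exact not_admissible_of_centre_bad
    (not_goodAtScale_centre_of_intruders (locHom_fcc_centre hrange) (by norm_num) hcard hS hlt) hA

/-- ★★ **(P2) PRUNE, hcp family.** [folklore] -/
theorem not_realised_hcp_of_intruders {G : E3 →L[ℝ] E3} {ξ : E3} {S : Finset E3} (hcard : 13 ≤ S.card)
    (hS : ∀ v ∈ S, v ≠ 0 ∧ v ∈ {v : E3 | ∃ b : Fin 3 → ℤ, v = latPt G hexFrame b ∨ v = latPt G hexFrame b + G (hcpShift + ξ)} ∧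
      ‖v‖ < 15 / 2)
    (hlt : ∀ v ∈ S, ∀ w ∈ {v : E3 | ∃ b : Fin 3 → ℤ, v = latPt G hexFrame b ∨ v = latPt G hexFrame b + G (hcpShift + ξ)},
      w ≠ 0 → ‖w‖ ≤ 3 / 2 → ‖v‖ < 13 / 10 * ‖w‖) :
    ¬∃ (M : ℕ) (z : Fin M → E3) (c : Fin M), Admissible M z c ∧
      Set.range z = {x : E3 | dist x (z c) ≤ 133 / 10 ∧ ∃ a : Fin 3 → ℤ,
        x = z c + latPt G hexFrame a ∨ x = z c + latPt G hexFrame a + G (hcpShift + ξ)} := by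
  rintro ⟨M, z, c, hA, hrange⟩
  exact not_admissible_of_centre_bad
    (not_goodAtScale_centre_of_intruders (locHom_hcp_centre hrange) (by norm_num) hcard hS hlt) hA

end Summit.AtomisticToContinuum.Crystallization.Theorems.FrustratedLawDichotomyStrainedPatchHomPrunesFit

end
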